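import Literature.Computability.AlgebraicComplexity.ArithCircuitProofs
import Literature.Computability.AlgebraicComplexity.CircuitArithmetization
import Literature.Computability.AlgebraicComplexity.ValiantClasses
import HarnessLib

/-!
# `VNP` is closed under sums and scalar multiples

Robustness of Valiant's class of p-definable families (Bürgisser 2024 survey, §3.1: "all the
complexity classes introduced before are closed under … taking sums, products"; Valiant 1982): for
the tree's predicate `IsVNPFamily` (`ValiantClasses.lean`, Bürgisser 2000 Def. 2.5 literally) we
prove closure under scalar multiples `C (a n) * f n` (`IsVNPFamily.C_mul`), sums
(`IsVNPFamily.add`), negation and differences (`IsVNPFamily.neg`, `IsVNPFamily.sub`), and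
products (`IsVNPFamily.mul`, witness `∑_{(y,z)} G₁(x,y) G₂(x,z)`), over every commutative ring. The sum needs the usual padding of the two Boolean sums to a common block:
`∑_y G₁(x,y) + ∑_z G₂(x,z) = ∑_{(y,z)} (G₁(x,y)·∏_j (1 - z_j) + G₂(x,z)·∏_i (1 - y_i))`
(`boolSum_addWitness`), since `∑_z ∏_j (1 - z_j) = 1` over `z ∈ {0,1}^{u₂}`.

## References

* P. Bürgisser, *Completeness classes in algebraic complexity theory*, arXiv:2406.06217 (2024),
  §3.1 (Robustness).
* L. G. Valiant, *Reducibility by algebraic projections*, L'Enseignement Math. 28 (1982), §3.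
-/

noncomputable section

open MvPolynomial

universe u v

namespace Literature.Computability.AlgebraicComplexity

variable {k : Type u} [CommRing k]

namespace VNPSum

/-- The indicator `∏_{t} (1 - X (ι t))` that all the listed Boolean variables vanish. [folklore] -/
def allZero {τ : Type v} {m : ℕ} (ι : Fin m → τ) : MvPolynomial τ k :=
  ∏ t : Fin m, (1 - X (ι t))

/-- **The padded witness of a sum**: `G₁(x, y)·∏_j (1 - z_j) + G₂(x, z)·∏_i (1 - y_i)` on the
common Boolean block `(y, z) ∈ {0,1}^{u₁ + u₂}`. [cite: Burgisser2024Completeness, §3.1] -/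
def addWitness {τ : Type v} {u₁ u₂ : ℕ} (G₁ : MvPolynomial (τ ⊕ Fin u₁) k)
    (G₂ : MvPolynomial (τ ⊕ Fin u₂) k) : MvPolynomial (τ ⊕ Fin (u₁ + u₂)) k :=
  rename (Sum.map id (Fin.castAdd u₂)) G₁ *
      allZero (fun j : Fin u₂ => (Sum.inr (Fin.natAdd u₁ j) : τ ⊕ Fin (u₁ + u₂))) +
    rename (Sum.map id (Fin.natAdd u₁)) G₂ *
      allZero (fun i : Fin u₁ => (Sum.inr (Fin.castAdd u₂ i) : τ ⊕ Fin (u₁ + u₂)))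

variable {τ : Type v}

/-- The Boolean substitution of `boolSum` at an assignment `c`. [folklore] -/
def bsub {m : ℕ} (c : Fin m → Bool) : τ ⊕ Fin m → MvPolynomial τ k :=
  Sum.elim X fun j => if c j then (1 : MvPolynomial τ k) else 0

/-- The block decomposition of an assignment of `Fin (u₁ + u₂)`. [folklore] -/
def glue {u₁ u₂ : ℕ} (y : Fin u₁ → Bool) (z : Fin u₂ → Bool) : Fin (u₁ + u₂) → Bool :=
  fun j => Sum.elim y z (finSumFinEquiv.symm j)

omit [CommRing k] in
/-- `glue` on the first block. [folklore] -/
@[simp] private theorem glue_castAdd {u₁ u₂ : ℕ} (y : Fin u₁ → Bool) (z : Fin u₂ → Bool) (i : Fin u₁) :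
    glue y z (Fin.castAdd u₂ i) = y i := by
  simp [glue]

omit [CommRing k] in
/-- `glue` on the second block. [folklore] -/
@[simp] private theorem glue_natAdd {u₁ u₂ : ℕ} (y : Fin u₁ → Bool) (z : Fin u₂ → Bool) (j : Fin u₂) :
    glue y z (Fin.natAdd u₁ j) = z j := by
  simp [glue]

omit [CommRing k] in
/-- Splitting a sum over assignments of `Fin (u₁ + u₂)` into the two blocks. [folklore] -/
private theorem sum_split {M : Type*} [AddCommMonoid M] {u₁ u₂ : ℕ}
    (Φ : (Fin (u₁ + u₂) → Bool) → M) :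
    ∑ c : Fin (u₁ + u₂) → Bool, Φ c =
      ∑ y : Fin u₁ → Bool, ∑ z : Fin u₂ → Bool, Φ (glue y z) := by
  rw [← Fintype.sum_prod_type']
  let E : ((Fin u₁ → Bool) × (Fin u₂ → Bool)) ≃ (Fin (u₁ + u₂) → Bool) :=
    (Equiv.sumArrowEquivProdArrow _ _ _).symm.trans (Equiv.arrowCongr finSumFinEquiv (Equiv.refl Bool))
  refine Fintype.sum_equiv E.symm _ _ fun c => ?_
  have hc : glue (E.symm c).1 (E.symm c).2 = E (E.symm c) := rfl
  rw [hc, Equiv.apply_symm_apply]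

/-- `allZero` under a Boolean substitution: `1` if all the listed bits vanish, else `0`. [folklore] -/
private theorem aeval_allZero {m n : ℕ} (c : Fin m → Bool) (ι : Fin n → Fin m) :
    aeval (bsub (k := k) (τ := τ) c) (allZero (k := k) (fun t => (Sum.inr (ι t) : τ ⊕ Fin m))) =
      if (∀ t, c (ι t) = false) then 1 else 0 := by
  unfold allZero
  rw [map_prod]
  by_cases h : ∀ t, c (ι t) = false
  · rw [if_pos h]
    refine Finset.prod_eq_one fun t _ => ?_
    simp [bsub, h t]
  · rw [if_neg h]
    push Not at h
    obtain ⟨t, ht⟩ := h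
    refine Finset.prod_eq_zero (Finset.mem_univ t) ?_
    simp [bsub, ht]

/-- The first summand of the padded witness under the substitution at `(y, z)`. [folklore] -/
private theorem aeval_fst {u₁ u₂ : ℕ} (G₁ : MvPolynomial (τ ⊕ Fin u₁) k) (y : Fin u₁ → Bool)
    (z : Fin u₂ → Bool) :
    aeval (bsub (k := k) (glue y z)) (rename (Sum.map id (Fin.castAdd u₂)) G₁) =
      aeval (bsub (k := k) y) G₁ := by
  have h : (bsub (k := k) (τ := τ) (glue y z)) ∘ Sum.map id (Fin.castAdd u₂) = bsub y := by
    funext v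
    rcases v with t | i
    · rfl
    · simp [bsub]
  rw [aeval_rename, h]

/-- The second summand of the padded witness under the substitution at `(y, z)`. [folklore] -/
private theorem aeval_snd {u₁ u₂ : ℕ} (G₂ : MvPolynomial (τ ⊕ Fin u₂) k) (y : Fin u₁ → Bool)
    (z : Fin u₂ → Bool) :
    aeval (bsub (k := k) (glue y z)) (rename (Sum.map id (Fin.natAdd u₁)) G₂) =
      aeval (bsub (k := k) z) G₂ := by
  have h : (bsub (k := k) (τ := τ) (glue y z)) ∘ Sum.map id (Fin.natAdd u₁) = bsub z := by
    funext v
    rcases v with t | j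
    · rfl
    · simp [bsub]
  rw [aeval_rename, h]

omit [CommRing k] in
/-- `∀ t, c t = false` is `c = 0`. [folklore] -/
private theorem forall_eq_false_iff {m : ℕ} (c : Fin m → Bool) :
    (∀ t, c t = false) ↔ c = fun _ => false :=
  ⟨fun h => funext h, fun h t => by rw [h]⟩

/-- **The Boolean sum of the padded witness is the sum of the two Boolean sums.**
[cite: Burgisser2024Completeness, §3.1] -/
theorem boolSum_addWitness {u₁ u₂ : ℕ} (G₁ : MvPolynomial (τ ⊕ Fin u₁) k)
    (G₂ : MvPolynomial (τ ⊕ Fin u₂) k) :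
    boolSum (addWitness G₁ G₂) = boolSum G₁ + boolSum G₂ := by
  classical
  have h1 : boolSum (addWitness G₁ G₂) =
      ∑ c : Fin (u₁ + u₂) → Bool, aeval (bsub (k := k) c) (addWitness G₁ G₂) := rfl
  have h2 : boolSum G₁ = ∑ y : Fin u₁ → Bool, aeval (bsub (k := k) y) G₁ := rfl
  have h3 : boolSum G₂ = ∑ z : Fin u₂ → Bool, aeval (bsub (k := k) z) G₂ := rfl
  rw [h1, h2, h3, sum_split]
  simp only [addWitness, map_add, map_mul, aeval_fst, aeval_snd, aeval_allZero, glue_natAdd,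
    glue_castAdd, forall_eq_false_iff, mul_ite, mul_one, mul_zero, Finset.sum_add_distrib,
    Finset.sum_ite_eq', Finset.mem_univ, if_true]
  congr 1
  rw [Finset.sum_comm]
  simp only [Finset.sum_ite_eq', Finset.mem_univ, if_true]

/-- `L(allZero) ≤ 3m`. [cite: Burgisser2000, Def. 2.1] -/
private theorem complexity_allZero_le {m : ℕ} (ι : Fin m → τ) :
    complexity (allZero (k := k) ι) ≤ 3 * m := by
  unfold allZero
  refine (complexity_finset_prod_le _ _).trans ?_
  have h1 : ∀ t : Fin m, complexity (1 - (X (ι t) : MvPolynomial τ k)) ≤ 2 := fun t =>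
    (CircuitArith.complexity_one_sub_le _).trans (by rw [complexity_X_holds])
  calc ∑ t : Fin m, complexity (1 - (X (ι t) : MvPolynomial τ k)) + (Finset.univ : Finset (Fin m)).card
      ≤ ∑ _t : Fin m, 2 + (Finset.univ : Finset (Fin m)).card :=
        Nat.add_le_add_right (Finset.sum_le_sum fun t _ => h1 t) _
    _ = 3 * m := by simp; ring

/-- `deg(allZero) ≤ m`. [folklore] -/
private theorem totalDegree_allZero_le {m : ℕ} (ι : Fin m → τ) :
    (allZero (k := k) ι).totalDegree ≤ m := by
  unfold allZero
  refine (totalDegree_finsetProd _ _).trans ?_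
  calc ∑ t : Fin m, (1 - (X (ι t) : MvPolynomial τ k)).totalDegree ≤ ∑ _t : Fin m, 1 :=
        Finset.sum_le_sum fun t _ => (CircuitArith.totalDegree_one_sub_le _).trans
          (CircuitArith.totalDegree_X_le_one' (k := k) _)
    _ = m := by simp

/-- Cost of the padded witness: `L ≤ L(G₁) + L(G₂) + 3(u₁ + u₂) + 3`.
[cite: Burgisser2024Completeness, §3.1] -/
theorem complexity_addWitness_le {u₁ u₂ : ℕ} (G₁ : MvPolynomial (τ ⊕ Fin u₁) k)
    (G₂ : MvPolynomial (τ ⊕ Fin u₂) k) :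
    complexity (addWitness G₁ G₂) ≤ complexity G₁ + complexity G₂ + 3 * (u₁ + u₂) + 3 := by
  unfold addWitness
  have hr1 := complexity_rename_le_holds' (k := k) (Sum.map id (Fin.castAdd u₂) : τ ⊕ Fin u₁ → τ ⊕ Fin (u₁ + u₂)) G₁
  have hr2 := complexity_rename_le_holds' (k := k) (Sum.map id (Fin.natAdd u₁) : τ ⊕ Fin u₂ → τ ⊕ Fin (u₁ + u₂)) G₂
  have hz1 := complexity_allZero_le (k := k) (fun j : Fin u₂ => (Sum.inr (Fin.natAdd u₁ j) : τ ⊕ Fin (u₁ + u₂)))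
  have hz2 := complexity_allZero_le (k := k) (fun i : Fin u₁ => (Sum.inr (Fin.castAdd u₂ i) : τ ⊕ Fin (u₁ + u₂)))
  have hm1 := complexity_mul_le_holds (rename (Sum.map id (Fin.castAdd u₂)) G₁)
    (allZero (k := k) (fun j : Fin u₂ => (Sum.inr (Fin.natAdd u₁ j) : τ ⊕ Fin (u₁ + u₂))))
  have hm2 := complexity_mul_le_holds (rename (Sum.map id (Fin.natAdd u₁)) G₂)
    (allZero (k := k) (fun i : Fin u₁ => (Sum.inr (Fin.castAdd u₂ i) : τ ⊕ Fin (u₁ + u₂))))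
  have ha := complexity_add_le_holds
    (rename (Sum.map id (Fin.castAdd u₂)) G₁ *
      allZero (k := k) (fun j : Fin u₂ => (Sum.inr (Fin.natAdd u₁ j) : τ ⊕ Fin (u₁ + u₂))))
    (rename (Sum.map id (Fin.natAdd u₁)) G₂ *
      allZero (k := k) (fun i : Fin u₁ => (Sum.inr (Fin.castAdd u₂ i) : τ ⊕ Fin (u₁ + u₂))))
  omega

/-- Degree of the padded witness: `deg ≤ deg G₁ + deg G₂ + u₁ + u₂`. [folklore] -/
private theorem totalDegree_addWitness_le {u₁ u₂ : ℕ} (G₁ : MvPolynomial (τ ⊕ Fin u₁) k)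
    (G₂ : MvPolynomial (τ ⊕ Fin u₂) k) :
    (addWitness G₁ G₂).totalDegree ≤ G₁.totalDegree + G₂.totalDegree + u₁ + u₂ := by
  unfold addWitness
  refine (totalDegree_add _ _).trans (max_le ?_ ?_)
  · refine (totalDegree_mul _ _).trans ?_
    have := totalDegree_rename_le (Sum.map id (Fin.castAdd u₂) : τ ⊕ Fin u₁ → τ ⊕ Fin (u₁ + u₂)) G₁
    have := totalDegree_allZero_le (k := k) (fun j : Fin u₂ => (Sum.inr (Fin.natAdd u₁ j) : τ ⊕ Fin (u₁ + u₂)))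
    omega
  · refine (totalDegree_mul _ _).trans ?_
    have := totalDegree_rename_le (Sum.map id (Fin.natAdd u₁) : τ ⊕ Fin u₂ → τ ⊕ Fin (u₁ + u₂)) G₂
    have := totalDegree_allZero_le (k := k) (fun i : Fin u₁ => (Sum.inr (Fin.castAdd u₂ i) : τ ⊕ Fin (u₁ + u₂)))
    omega

/-- Boolean sums commute with scalars: `∑_e (C a · g)(X, e) = C a · ∑_e g(X, e)`.
[cite: Burgisser2024Completeness, §3.1] -/
theorem boolSum_C_mul {m : ℕ} (a : k) (g : MvPolynomial (τ ⊕ Fin m) k) :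
    boolSum (C a * g) = C a * boolSum g := by
  have h1 : boolSum (C a * g) = ∑ c : Fin m → Bool, aeval (bsub (k := k) c) (C a * g) := rfl
  have h2 : boolSum g = ∑ c : Fin m → Bool, aeval (bsub (k := k) c) g := rfl
  rw [h1, h2, Finset.mul_sum]
  refine Finset.sum_congr rfl fun c _ => ?_
  rw [map_mul, aeval_C, MvPolynomial.algebraMap_eq]

/-- **The witness of a product**: `G₁(x, y) · G₂(x, z)` on the common Boolean block
`(y, z) ∈ {0,1}^{u₁ + u₂}`. [cite: Burgisser2024Completeness, §3.1] -/
def mulWitness {u₁ u₂ : ℕ} (G₁ : MvPolynomial (τ ⊕ Fin u₁) k)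
    (G₂ : MvPolynomial (τ ⊕ Fin u₂) k) : MvPolynomial (τ ⊕ Fin (u₁ + u₂)) k :=
  rename (Sum.map id (Fin.castAdd u₂)) G₁ * rename (Sum.map id (Fin.natAdd u₁)) G₂

/-- **The Boolean sum of the product witness is the product of the Boolean sums**:
`∑_{(y,z)} G₁(x,y) G₂(x,z) = (∑_y G₁(x,y)) (∑_z G₂(x,z))`. [cite: Burgisser2024Completeness, §3.1] -/
theorem boolSum_mulWitness {u₁ u₂ : ℕ} (G₁ : MvPolynomial (τ ⊕ Fin u₁) k)
    (G₂ : MvPolynomial (τ ⊕ Fin u₂) k) :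
    boolSum (mulWitness G₁ G₂) = boolSum G₁ * boolSum G₂ := by
  classical
  have h1 : boolSum (mulWitness G₁ G₂) =
      ∑ c : Fin (u₁ + u₂) → Bool, aeval (bsub (k := k) c) (mulWitness G₁ G₂) := rfl
  have h2 : boolSum G₁ = ∑ y : Fin u₁ → Bool, aeval (bsub (k := k) y) G₁ := rfl
  have h3 : boolSum G₂ = ∑ z : Fin u₂ → Bool, aeval (bsub (k := k) z) G₂ := rfl
  rw [h1, h2, h3, sum_split, Finset.sum_mul_sum]
  refine Finset.sum_congr rfl fun y _ => Finset.sum_congr rfl fun z _ => ?_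
  simp only [mulWitness, map_mul, aeval_fst, aeval_snd]

/-- Cost of the product witness: `L ≤ L(G₁) + L(G₂) + 1`. [cite: Burgisser2024Completeness, §3.1] -/
theorem complexity_mulWitness_le {u₁ u₂ : ℕ} (G₁ : MvPolynomial (τ ⊕ Fin u₁) k)
    (G₂ : MvPolynomial (τ ⊕ Fin u₂) k) :
    complexity (mulWitness G₁ G₂) ≤ complexity G₁ + complexity G₂ + 1 := by
  unfold mulWitness
  have hr1 := complexity_rename_le_holds' (k := k) (Sum.map id (Fin.castAdd u₂) : τ ⊕ Fin u₁ → τ ⊕ Fin (u₁ + u₂)) G₁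
  have hr2 := complexity_rename_le_holds' (k := k) (Sum.map id (Fin.natAdd u₁) : τ ⊕ Fin u₂ → τ ⊕ Fin (u₁ + u₂)) G₂
  have hm := complexity_mul_le_holds (rename (Sum.map id (Fin.castAdd u₂)) G₁)
    (rename (Sum.map id (Fin.natAdd u₁) : τ ⊕ Fin u₂ → τ ⊕ Fin (u₁ + u₂)) G₂)
  omega

/-- Degree of the product witness: `deg ≤ deg G₁ + deg G₂`. [folklore] -/
private theorem totalDegree_mulWitness_le {u₁ u₂ : ℕ} (G₁ : MvPolynomial (τ ⊕ Fin u₁) k)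
    (G₂ : MvPolynomial (τ ⊕ Fin u₂) k) :
    (mulWitness G₁ G₂).totalDegree ≤ G₁.totalDegree + G₂.totalDegree := by
  unfold mulWitness
  refine (totalDegree_mul _ _).trans (Nat.add_le_add ?_ ?_)
  · exact totalDegree_rename_le (Sum.map id (Fin.castAdd u₂) : τ ⊕ Fin u₁ → τ ⊕ Fin (u₁ + u₂)) G₁
  · exact totalDegree_rename_le (Sum.map id (Fin.natAdd u₁) : τ ⊕ Fin u₂ → τ ⊕ Fin (u₁ + u₂)) G₂

end VNPSum

open VNPSum

variable {σ : ℕ → Type v} [∀ n, Fintype (σ n)]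

/-- **`VNP` is closed under scalar multiples** `C (a n) · f n`. [cite: Burgisser2024Completeness, §3.1] -/
theorem IsVNPFamily.C_mul {f : ∀ n, MvPolynomial (σ n) k} (hf : IsVNPFamily f) (a : ℕ → k) :
    IsVNPFamily (fun n => C (a n) * f n) := by
  obtain ⟨⟨hcard, hdeg⟩, u, G, ⟨⟨hGcard, hGdeg⟩, hGcomp⟩, hFG⟩ := hf
  refine ⟨⟨hcard, hdeg.mono fun n => ?_⟩, u, fun n => C (a n) * G n, ⟨⟨hGcard, hGdeg.mono fun n => ?_⟩, ?_⟩,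
    fun n => ?_⟩
  · exact (totalDegree_mul _ _).trans (by rw [totalDegree_C, zero_add])
  · exact (totalDegree_mul _ _).trans (by rw [totalDegree_C, zero_add])
  · refine (IsPBounded.add_holds hGcomp (IsPBounded.const 1)).mono fun n => ?_
    exact (complexity_mul_le_holds _ _).trans (by rw [complexity_C_holds]; omega)
  · show C (a n) * f n = boolSum (C (a n) * G n)
    rw [boolSum_C_mul, hFG n]

/-- **`VNP` is closed under sums.** [cite: Burgisser2024Completeness, §3.1] -/
theorem IsVNPFamily.add {f g : ∀ n, MvPolynomial (σ n) k} (hf : IsVNPFamily f) (hg : IsVNPFamily g) :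
    IsVNPFamily (fun n => f n + g n) := by
  obtain ⟨⟨hcard, hdeg⟩, u₁, G₁, ⟨⟨hG₁card, hG₁deg⟩, hG₁comp⟩, hFG₁⟩ := hf
  obtain ⟨⟨_, hdeg'⟩, u₂, G₂, ⟨⟨hG₂card, hG₂deg⟩, hG₂comp⟩, hFG₂⟩ := hg
  have hu₁ : IsPBounded u₁ := by
    have h : (fun n => Fintype.card (σ n ⊕ Fin (u₁ n))) = fun n => Fintype.card (σ n) + u₁ n := by
      funext n; simp
    rw [h] at hG₁card
    exact hG₁card.mono fun n => Nat.le_add_left _ _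
  have hu₂ : IsPBounded u₂ := by
    have h : (fun n => Fintype.card (σ n ⊕ Fin (u₂ n))) = fun n => Fintype.card (σ n) + u₂ n := by
      funext n; simp
    rw [h] at hG₂card
    exact hG₂card.mono fun n => Nat.le_add_left _ _
  refine ⟨⟨hcard, (IsPBounded.add_holds hdeg hdeg').mono fun n =>
      (totalDegree_add _ _).trans (max_le (Nat.le_add_right _ _) (Nat.le_add_left _ _))⟩,
    fun n => u₁ n + u₂ n, fun n => addWitness (G₁ n) (G₂ n), ⟨⟨?_, ?_⟩, ?_⟩, fun n => ?_⟩
  · have h : (fun n => Fintype.card (σ n ⊕ Fin (u₁ n + u₂ n))) =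
        fun n => Fintype.card (σ n) + (u₁ n + u₂ n) := by
      funext n; simp
    rw [h]
    exact IsPBounded.add_holds hcard (IsPBounded.add_holds hu₁ hu₂)
  · exact (IsPBounded.add_holds (IsPBounded.add_holds (IsPBounded.add_holds hG₁deg hG₂deg) hu₁) hu₂).mono
      fun n => totalDegree_addWitness_le (G₁ n) (G₂ n)
  · exact (IsPBounded.add_holds (IsPBounded.add_holds (IsPBounded.add_holds hG₁comp hG₂comp)
      (IsPBounded.mul_holds (IsPBounded.const 3) (IsPBounded.add_holds hu₁ hu₂))) (IsPBounded.const 3)).mono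
      fun n => complexity_addWitness_le (G₁ n) (G₂ n)
  · show f n + g n = boolSum (addWitness (G₁ n) (G₂ n))
    rw [boolSum_addWitness, hFG₁ n, hFG₂ n]

/-- **`VNP` is closed under negation.** [cite: Burgisser2024Completeness, §3.1] -/
theorem IsVNPFamily.neg {f : ∀ n, MvPolynomial (σ n) k} (hf : IsVNPFamily f) :
    IsVNPFamily (fun n => -f n) := by
  have h := hf.C_mul (fun _ => (-1 : k))
  have e : (fun n => C (-1 : k) * f n) = fun n => -f n := by
    funext n; simp
  rwa [e] at h

/-- **`VNP` is closed under differences.** [cite: Burgisser2024Completeness, §3.1] -/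
theorem IsVNPFamily.sub {f g : ∀ n, MvPolynomial (σ n) k} (hf : IsVNPFamily f) (hg : IsVNPFamily g) :
    IsVNPFamily (fun n => f n - g n) := by
  have h := hf.add hg.neg
  have e : (fun n => f n + -g n) = fun n => f n - g n := by
    funext n; rw [sub_eq_add_neg]
  rwa [e] at h

/-- **`VNP` is closed under products.** [cite: Burgisser2024Completeness, §3.1] -/
theorem IsVNPFamily.mul {f g : ∀ n, MvPolynomial (σ n) k} (hf : IsVNPFamily f) (hg : IsVNPFamily g) :
    IsVNPFamily (fun n => f n * g n) := by
  obtain ⟨⟨hcard, hdeg⟩, u₁, G₁, ⟨⟨hG₁card, hG₁deg⟩, hG₁comp⟩, hFG₁⟩ := hf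
  obtain ⟨⟨_, hdeg'⟩, u₂, G₂, ⟨⟨hG₂card, hG₂deg⟩, hG₂comp⟩, hFG₂⟩ := hg
  have hu₁ : IsPBounded u₁ := by
    have h : (fun n => Fintype.card (σ n ⊕ Fin (u₁ n))) = fun n => Fintype.card (σ n) + u₁ n := by
      funext n; simp
    rw [h] at hG₁card
    exact hG₁card.mono fun n => Nat.le_add_left _ _
  have hu₂ : IsPBounded u₂ := by
    have h : (fun n => Fintype.card (σ n ⊕ Fin (u₂ n))) = fun n => Fintype.card (σ n) + u₂ n := by
      funext n; simp
    rw [h] at hG₂card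
    exact hG₂card.mono fun n => Nat.le_add_left _ _
  refine ⟨⟨hcard, (IsPBounded.add_holds hdeg hdeg').mono fun n => totalDegree_mul _ _⟩,
    fun n => u₁ n + u₂ n, fun n => mulWitness (G₁ n) (G₂ n), ⟨⟨?_, ?_⟩, ?_⟩, fun n => ?_⟩
  · have h : (fun n => Fintype.card (σ n ⊕ Fin (u₁ n + u₂ n))) =
        fun n => Fintype.card (σ n) + (u₁ n + u₂ n) := by
      funext n; simp
    rw [h]
    exact IsPBounded.add_holds hcard (IsPBounded.add_holds hu₁ hu₂)
  · exact (IsPBounded.add_holds hG₁deg hG₂deg).mono fun n => totalDegree_mulWitness_le (G₁ n) (G₂ n)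
  · exact (IsPBounded.add_holds (IsPBounded.add_holds hG₁comp hG₂comp) (IsPBounded.const 1)).mono
      fun n => complexity_mulWitness_le (G₁ n) (G₂ n)
  · show f n * g n = boolSum (mulWitness (G₁ n) (G₂ n))
    rw [boolSum_mulWitness, hFG₁ n, hFG₂ n]

end Literature.Computability.AlgebraicComplexity
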